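import Summits.AtomisticToContinuum.Crystallization.Theorems.SquareWellLayerCakeGapTwelveToBarlowCombinatorialLayeringOfParts

/-!
# Combinatorial layering (B1a of `GapTwelveToBarlow`): the typed reduction at window `16 * D`

Crux `SquareWellLayerCake.GapTwelveToBarlow` (stmt-AtomisticToContinuum-15807), line `Sketch`, skeleton v6.
The wave-4 reduction `stub_combinatorialLayering_of_parts : (S3δ) → (H_develop) → stub`
(`…CombinatorialLayeringOfParts`) was stated with the all-Good / five-fold-free WINDOW `2 * D`
about the centre `x i`.  The level-budget finding of wave 4 (the layer-by-layer finite development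
consumes `≈ 12·D` chart levels to cover the Euclidean `D`-ball and the ideal `D/2`-ball) made the
lead reshape the window constant of `stub_combinatorialLayering` and of its residual `(H_develop)`
(now the stub `stub_develop`) to `16 * D` (skeleton v6).  This file is the corresponding re-landing:
the SAME proofs with the window constant changed, obtained from the `2 * D` lemmas at `D' := 8 * D`.

* `zchart_of_deep16` (anchor): under (ExtendedGap) and the one-shell link census `(S3δ)`, every site
  `j` with `dist (x i) (x j) + 10 ≤ 16 D` of an all-Good, five-fold-free `16D`-ball carries an
  integer chart.
* `transfers_of_deep16`: under (ExtendedGap) and the lens lemma, charts at bonded such sites transfer.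
* `stub_combinatorialLayering_of_parts16 : (S3δ) → (H_develop at 16 D) → (stub at 16 D)` — this is
  the type of the skeleton's plumbing stub `stub_combinatorialLayeringOfParts16`, verbatim — and
  `stub_combinatorialLayering_of_deepParts16`, the same from the census in deep form `(S3δ-deep)`.

Nothing is defined; no named fact is used.
-/

namespace Summit.AtomisticToContinuum.Crystallization.Theorems.SquareWellLayerCakeGapTwelveToBarlow

open Literature.Geometry.DiscreteGeometry Literature.MathematicalPhysics.StatisticalMechanics

/-- **Integer charts at deep sites, window `16 * D`** (anchor of this file).  Under (ExtendedGap)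
and the one-shell link census `(S3δ)`, in an all-Good `16D`-ball about `x i` without five-fold
bonds every site `j` with `dist (x i) (x j) + 10 ≤ 16 D` carries an integer chart `(T, e)`
(`T = 3 • fccTab` or `hcpTab`, `e` injective onto the neighbours of `j`, bonds among distinct
labels ↔ label vectors at squared distance `18`).  From `zchart_of_deep` at `8 * D`. [folklore] -/
theorem zchart_of_deep16 :
    (∀ (N : ℕ) (x : Fin N → EuclideanSpace ℝ (Fin 3)) (i j : Fin N), (∀ l : Fin N, dist (x i) (x
    l) ≤ 4 → ((∀ j' : Fin N, dist (x l) (x j') ≤ 11 / 10 → ∀ k : Fin N, k ≠ j' → (55 : ℝ) / 57 ≤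
    dist (x j') (x k)) ∧ (Finset.univ.filter fun j' : Fin N => j' ≠ l ∧ dist (x l) (x j') ≤
    1).card = 12 ∧ (Finset.univ.filter fun j' : Fin N => j' ≠ l ∧ dist (x l) (x j') ≤ 11 /
    10).card ≤ 12)) → 1 < dist (x i) (x j) → (131 : ℝ) / 100 ≤ dist (x i) (x j)) → (∀ (N : ℕ) (x
    : Fin N → EuclideanSpace ℝ (Fin 3)) (j : Fin N), ((∀ j' : Fin N, dist (x j) (x j') ≤ 11 / 10
    → ∀ k' : Fin N, k' ≠ j' → (55 : ℝ) / 57 ≤ dist (x j') (x k')) ∧ (Finset.univ.filter fun j' :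
    Fin N => j' ≠ j ∧ dist (x j) (x j') ≤ 1).card = 12 ∧ (Finset.univ.filter fun j' : Fin N =>
    j' ≠ j ∧ dist (x j) (x j') ≤ 11 / 10).card ≤ 12) → (∀ l l' : Fin N, dist (x j) (x l) ≤ 1 →
    dist (x j) (x l') ≤ 1 → 1 < dist (x l) (x l') → (131 : ℝ) / 100 ≤ dist (x l) (x l')) → ∃ e :
    Fin 12 → Fin N, Function.Injective e ∧ (∀ a : Fin 12, e a ≠ j ∧ dist (x j) (x (e a)) ≤ 1) ∧
    ((∀ a b : Fin 12, a ≠ b → (dist (x (e a)) (x (e b)) ≤ 1 ↔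
    Literature.Geometry.DiscreteGeometry.fccAdj a b)) ∨ (∀ a b : Fin 12, a ≠ b → (dist (x (e a))
    (x (e b)) ≤ 1 ↔ Literature.Geometry.DiscreteGeometry.hcpAdj a b)) ∨ (∀ a b : Fin 12, a ≠ b →
    (dist (x (e a)) (x (e b)) ≤ 1 ↔
    Summit.AtomisticToContinuum.Crystallization.Theorems.SquareWellLayerCakeGapTwelveToBarlow.bppAdj
    a b = true)))) → ∀ (N : ℕ) (x : Fin N → EuclideanSpace ℝ (Fin 3)) (i : Fin N) (D : ℝ), (∀ j
    : Fin N, dist (x i) (x j) ≤ 16 * D → ((∀ j' : Fin N, dist (x j) (x j') ≤ 11 / 10 → ∀ k : Fin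
    N, k ≠ j' → (55 : ℝ) / 57 ≤ dist (x j') (x k)) ∧ (Finset.univ.filter fun j' : Fin N => j' ≠
    j ∧ dist (x j) (x j') ≤ 1).card = 12 ∧ (Finset.univ.filter fun j' : Fin N => j' ≠ j ∧ dist
    (x j) (x j') ≤ 11 / 10).card ≤ 12)) → (∀ j k : Fin N, dist (x i) (x j) ≤ 16 * D → ¬ (j ≠ k ∧
    dist (x j) (x k) ≤ 1 ∧ (Finset.univ.filter fun l : Fin N => l ≠ j ∧ l ≠ k ∧ dist (x j) (x l)
    ≤ 1 ∧ dist (x k) (x l) ≤ 1).card = 5)) → ∀ j : Fin N, dist (x i) (x j) + 10 ≤ 16 * D → ∃ (T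
    : Fin 12 → Fin 3 → ℤ) (e : Fin 12 → Fin N), ((((T = fun a : Fin 12 => 3 •
    Literature.Geometry.DiscreteGeometry.fccTab a) ∨ T =
    Literature.Geometry.DiscreteGeometry.hcpTab) ∧ Function.Injective e ∧ (∀ a : Fin 12, e a ≠ j
    ∧ dist (x j) (x (e a)) ≤ 1) ∧ (∀ k : Fin N, k ≠ j → dist (x j) (x k) ≤ 1 → ∃ a : Fin 12, e a
    = k) ∧ (∀ a b : Fin 12, a ≠ b → (dist (x (e a)) (x (e b)) ≤ 1 ↔
    Literature.Geometry.DiscreteGeometry.sqNormInt (T a - T b) = 18)))) :=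
  fun hGap hCensus N x i D hGood hFF j hj =>
    zchart_of_deep hGap hCensus N x i (8 * D) (fun j hj => hGood j (by linarith))
      (fun j k hj => hFF j k (by linarith)) j (by linarith)

/-- **Transfer at deep sites, window `16 * D`.**  Under (ExtendedGap) and the lens lemma
(hypothesis here; it is `lens_five_points`), in an all-Good `16D`-ball about `x i` any two integer
charts at bonded sites `j ≠ j'` with `dist (x i) (x j) + 10 ≤ 16 D`, `dist (x i) (x j') + 10 ≤ 16 D`
transfer.  From `transfers_of_deep` at `8 * D`. [folklore] -/
theorem transfers_of_deep16 :
    (∀ (N : ℕ) (x : Fin N → EuclideanSpace ℝ (Fin 3)) (i j : Fin N), (∀ l : Fin N, dist (x i) (x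
    l) ≤ 4 → ((∀ j' : Fin N, dist (x l) (x j') ≤ 11 / 10 → ∀ k : Fin N, k ≠ j' → (55 : ℝ) / 57 ≤
    dist (x j') (x k)) ∧ (Finset.univ.filter fun j' : Fin N => j' ≠ l ∧ dist (x l) (x j') ≤
    1).card = 12 ∧ (Finset.univ.filter fun j' : Fin N => j' ≠ l ∧ dist (x l) (x j') ≤ 11 /
    10).card ≤ 12)) → 1 < dist (x i) (x j) → (131 : ℝ) / 100 ≤ dist (x i) (x j)) → (∀ x y a b c
    : EuclideanSpace ℝ (Fin 3), (55 : ℝ) / 57 ≤ dist x y → dist x y ≤ 1 → (55 : ℝ) / 57 ≤ dist x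
    a → dist x a ≤ 1 → (55 : ℝ) / 57 ≤ dist x b → dist x b ≤ 1 → (55 : ℝ) / 57 ≤ dist x c → dist
    x c ≤ 1 → (55 : ℝ) / 57 ≤ dist y a → dist y a ≤ 1 → (55 : ℝ) / 57 ≤ dist y b → dist y b ≤ 1
    → (55 : ℝ) / 57 ≤ dist y c → dist y c ≤ 1 → (55 : ℝ) / 57 ≤ dist a b → dist a b ≤ 1 → (131 :
    ℝ) / 100 ≤ dist a c → dist a c ^ 2 + ((131 : ℝ) / 100) ^ 2 ≤ 4 → (131 : ℝ) / 100 ≤ dist b c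
    → dist b c ^ 2 + ((131 : ℝ) / 100) ^ 2 ≤ 4 → False) → ∀ (N : ℕ) (x : Fin N → EuclideanSpace
    ℝ (Fin 3)) (i : Fin N) (D : ℝ), (∀ j : Fin N, dist (x i) (x j) ≤ 16 * D → ((∀ j' : Fin N,
    dist (x j) (x j') ≤ 11 / 10 → ∀ k : Fin N, k ≠ j' → (55 : ℝ) / 57 ≤ dist (x j') (x k)) ∧
    (Finset.univ.filter fun j' : Fin N => j' ≠ j ∧ dist (x j) (x j') ≤ 1).card = 12 ∧
    (Finset.univ.filter fun j' : Fin N => j' ≠ j ∧ dist (x j) (x j') ≤ 11 / 10).card ≤ 12)) → (∀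
    (j j' : Fin N) (T T' : Fin 12 → Fin 3 → ℤ) (e e' : Fin 12 → Fin N), dist (x i) (x j) + 10 ≤
    16 * D → dist (x i) (x j') + 10 ≤ 16 * D → j ≠ j' → dist (x j) (x j') ≤ 1 → ((((T = fun a :
    Fin 12 => 3 • Literature.Geometry.DiscreteGeometry.fccTab a) ∨ T =
    Literature.Geometry.DiscreteGeometry.hcpTab) ∧ Function.Injective e ∧ (∀ a : Fin 12, e a ≠ j
    ∧ dist (x j) (x (e a)) ≤ 1) ∧ (∀ k : Fin N, k ≠ j → dist (x j) (x k) ≤ 1 → ∃ a : Fin 12, e a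
    = k) ∧ (∀ a b : Fin 12, a ≠ b → (dist (x (e a)) (x (e b)) ≤ 1 ↔
    Literature.Geometry.DiscreteGeometry.sqNormInt (T a - T b) = 18)))) → ((((T' = fun a : Fin
    12 => 3 • Literature.Geometry.DiscreteGeometry.fccTab a) ∨ T' =
    Literature.Geometry.DiscreteGeometry.hcpTab) ∧ Function.Injective e' ∧ (∀ a : Fin 12, e' a ≠
    j' ∧ dist (x j') (x (e' a)) ≤ 1) ∧ (∀ k : Fin N, k ≠ j' → dist (x j') (x k) ≤ 1 → ∃ a : Fin
    12, e' a = k) ∧ (∀ a b : Fin 12, a ≠ b → (dist (x (e' a)) (x (e' b)) ≤ 1 ↔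
    Literature.Geometry.DiscreteGeometry.sqNormInt (T' a - T' b) = 18)))) → ∀ a a' b b' : Fin
    12, e a = e' b → e a' = e' b' → Literature.Geometry.DiscreteGeometry.sqNormInt (T a - T a')
    = Literature.Geometry.DiscreteGeometry.sqNormInt (T' b - T' b')) :=
  fun hGap hlens N x i D hGood j j' T T' e e' hj hj' hne hb hc hc' =>
    transfers_of_deep hGap hlens N x i (8 * D) (fun j hj => hGood j (by linarith)) j j' T T' e e'
      (by linarith) (by linarith) hne hb hc hc'

/-- **`stub_combinatorialLayering` (window `16 * D`, skeleton v6) from its two residuals.**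
Hypotheses, in order: `(S3δ)` the one-shell link census (`stub_linkCensus`); `(H_develop)` at
window `16 * D` (`stub_develop`).  Conclusion: the v6 signature of `stub_combinatorialLayering`,
verbatim; the whole type is that of the skeleton's `stub_combinatorialLayeringOfParts16`. [folklore] -/
theorem stub_combinatorialLayering_of_parts16 :
    (∀ (N : ℕ) (x : Fin N → EuclideanSpace ℝ (Fin 3)) (j : Fin N), ((∀ j' : Fin N, dist (x j) (x
    j') ≤ 11 / 10 → ∀ k' : Fin N, k' ≠ j' → (55 : ℝ) / 57 ≤ dist (x j') (x k')) ∧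
    (Finset.univ.filter fun j' : Fin N => j' ≠ j ∧ dist (x j) (x j') ≤ 1).card = 12 ∧
    (Finset.univ.filter fun j' : Fin N => j' ≠ j ∧ dist (x j) (x j') ≤ 11 / 10).card ≤ 12) → (∀
    l l' : Fin N, dist (x j) (x l) ≤ 1 → dist (x j) (x l') ≤ 1 → 1 < dist (x l) (x l') → (131 :
    ℝ) / 100 ≤ dist (x l) (x l')) → ∃ e : Fin 12 → Fin N, Function.Injective e ∧ (∀ a : Fin 12,
    e a ≠ j ∧ dist (x j) (x (e a)) ≤ 1) ∧ ((∀ a b : Fin 12, a ≠ b → (dist (x (e a)) (x (e b)) ≤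
    1 ↔ Literature.Geometry.DiscreteGeometry.fccAdj a b)) ∨ (∀ a b : Fin 12, a ≠ b → (dist (x (e
    a)) (x (e b)) ≤ 1 ↔ Literature.Geometry.DiscreteGeometry.hcpAdj a b)) ∨ (∀ a b : Fin 12, a ≠
    b → (dist (x (e a)) (x (e b)) ≤ 1 ↔
    Summit.AtomisticToContinuum.Crystallization.Theorems.SquareWellLayerCakeGapTwelveToBarlow.bppAdj
    a b = true)))) → (∃ D₀ : ℝ, ∀ (N : ℕ) (x : Fin N → EuclideanSpace ℝ (Fin 3)) (i : Fin N) (D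
    : ℝ), D₀ ≤ D → (∀ j : Fin N, dist (x i) (x j) ≤ 16 * D → ((∀ j' : Fin N, dist (x j) (x j') ≤
    11 / 10 → ∀ k : Fin N, k ≠ j' → (55 : ℝ) / 57 ≤ dist (x j') (x k)) ∧ (Finset.univ.filter fun
    j' : Fin N => j' ≠ j ∧ dist (x j) (x j') ≤ 1).card = 12 ∧ (Finset.univ.filter fun j' : Fin N
    => j' ≠ j ∧ dist (x j) (x j') ≤ 11 / 10).card ≤ 12)) → (∀ j k : Fin N, dist (x i) (x j) ≤ 16
    * D → ¬ (j ≠ k ∧ dist (x j) (x k) ≤ 1 ∧ (Finset.univ.filter fun l : Fin N => l ≠ j ∧ l ≠ k ∧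
    dist (x j) (x l) ≤ 1 ∧ dist (x k) (x l) ≤ 1).card = 5)) → (∀ j : Fin N, dist (x i) (x j) +
    10 ≤ 16 * D → ∃ (T : Fin 12 → Fin 3 → ℤ) (e : Fin 12 → Fin N), ((((T = fun a : Fin 12 => 3 •
    Literature.Geometry.DiscreteGeometry.fccTab a) ∨ T =
    Literature.Geometry.DiscreteGeometry.hcpTab) ∧ Function.Injective e ∧ (∀ a : Fin 12, e a ≠ j
    ∧ dist (x j) (x (e a)) ≤ 1) ∧ (∀ k : Fin N, k ≠ j → dist (x j) (x k) ≤ 1 → ∃ a : Fin 12, e a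
    = k) ∧ (∀ a b : Fin 12, a ≠ b → (dist (x (e a)) (x (e b)) ≤ 1 ↔
    Literature.Geometry.DiscreteGeometry.sqNormInt (T a - T b) = 18))))) → (∀ (j j' : Fin N) (T
    T' : Fin 12 → Fin 3 → ℤ) (e e' : Fin 12 → Fin N), dist (x i) (x j) + 10 ≤ 16 * D → dist (x
    i) (x j') + 10 ≤ 16 * D → j ≠ j' → dist (x j) (x j') ≤ 1 → ((((T = fun a : Fin 12 => 3 •
    Literature.Geometry.DiscreteGeometry.fccTab a) ∨ T =
    Literature.Geometry.DiscreteGeometry.hcpTab) ∧ Function.Injective e ∧ (∀ a : Fin 12, e a ≠ j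
    ∧ dist (x j) (x (e a)) ≤ 1) ∧ (∀ k : Fin N, k ≠ j → dist (x j) (x k) ≤ 1 → ∃ a : Fin 12, e a
    = k) ∧ (∀ a b : Fin 12, a ≠ b → (dist (x (e a)) (x (e b)) ≤ 1 ↔
    Literature.Geometry.DiscreteGeometry.sqNormInt (T a - T b) = 18)))) → ((((T' = fun a : Fin
    12 => 3 • Literature.Geometry.DiscreteGeometry.fccTab a) ∨ T' =
    Literature.Geometry.DiscreteGeometry.hcpTab) ∧ Function.Injective e' ∧ (∀ a : Fin 12, e' a ≠
    j' ∧ dist (x j') (x (e' a)) ≤ 1) ∧ (∀ k : Fin N, k ≠ j' → dist (x j') (x k) ≤ 1 → ∃ a : Fin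
    12, e' a = k) ∧ (∀ a b : Fin 12, a ≠ b → (dist (x (e' a)) (x (e' b)) ≤ 1 ↔
    Literature.Geometry.DiscreteGeometry.sqNormInt (T' a - T' b) = 18)))) → ∀ a a' b b' : Fin
    12, e a = e' b → e a' = e' b' → Literature.Geometry.DiscreteGeometry.sqNormInt (T a - T a')
    = Literature.Geometry.DiscreteGeometry.sqNormInt (T' b - T' b')) → ∃ s : ℤ → ℤ, IsHaggSeq s
    ∧ ∃ φ : Fin N → EuclideanSpace ℝ (Fin 3), (∀ j : Fin N, dist (x i) (x j) ≤ D → φ j ∈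
    barlowStacking 1 (Real.sqrt (2 / 3)) s) ∧ (∀ j j' : Fin N, dist (x i) (x j) ≤ D → dist (x i)
    (x j') ≤ D → j ≠ j' → φ j ≠ φ j') ∧ (∀ j j' : Fin N, dist (x i) (x j) ≤ D → dist (x i) (x
    j') ≤ D → j ≠ j' → (dist (x j) (x j') ≤ 1 ↔ dist (φ j) (φ j') = 1)) ∧ (∀ p ∈ barlowStacking
    1 (Real.sqrt (2 / 3)) s, dist p (φ i) ≤ D / 2 → ∃ j : Fin N, dist (x i) (x j) ≤ D ∧ φ j =
    p)) → ((∀ (N : ℕ) (x : Fin N → EuclideanSpace ℝ (Fin 3)) (i j : Fin N), (∀ l : Fin N, dist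
    (x i) (x l) ≤ 4 → ((∀ j' : Fin N, dist (x l) (x j') ≤ 11 / 10 → ∀ k : Fin N, k ≠ j' → (55 :
    ℝ) / 57 ≤ dist (x j') (x k)) ∧ (Finset.univ.filter fun j' : Fin N => j' ≠ l ∧ dist (x l) (x
    j') ≤ 1).card = 12 ∧ (Finset.univ.filter fun j' : Fin N => j' ≠ l ∧ dist (x l) (x j') ≤ 11 /
    10).card ≤ 12)) → 1 < dist (x i) (x j) → (131 : ℝ) / 100 ≤ dist (x i) (x j)) → ∃ D₀ : ℝ, ∀
    (N : ℕ) (x : Fin N → EuclideanSpace ℝ (Fin 3)) (i : Fin N) (D : ℝ), D₀ ≤ D → (∀ j : Fin N,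
    dist (x i) (x j) ≤ 16 * D → ((∀ j' : Fin N, dist (x j) (x j') ≤ 11 / 10 → ∀ k : Fin N, k ≠
    j' → (55 : ℝ) / 57 ≤ dist (x j') (x k)) ∧ (Finset.univ.filter fun j' : Fin N => j' ≠ j ∧
    dist (x j) (x j') ≤ 1).card = 12 ∧ (Finset.univ.filter fun j' : Fin N => j' ≠ j ∧ dist (x j)
    (x j') ≤ 11 / 10).card ≤ 12)) → (∀ j k : Fin N, dist (x i) (x j) ≤ 16 * D → ¬ (j ≠ k ∧ dist
    (x j) (x k) ≤ 1 ∧ (Finset.univ.filter fun l : Fin N => l ≠ j ∧ l ≠ k ∧ dist (x j) (x l) ≤ 1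
    ∧ dist (x k) (x l) ≤ 1).card = 5)) → ∃ s : ℤ → ℤ, IsHaggSeq s ∧ ∃ φ : Fin N → EuclideanSpace
    ℝ (Fin 3), (∀ j : Fin N, dist (x i) (x j) ≤ D → φ j ∈ barlowStacking 1 (Real.sqrt (2 / 3))
    s) ∧ (∀ j j' : Fin N, dist (x i) (x j) ≤ D → dist (x i) (x j') ≤ D → j ≠ j' → φ j ≠ φ j') ∧
    (∀ j j' : Fin N, dist (x i) (x j) ≤ D → dist (x i) (x j') ≤ D → j ≠ j' → (dist (x j) (x j')
    ≤ 1 ↔ dist (φ j) (φ j') = 1)) ∧ (∀ p ∈ barlowStacking 1 (Real.sqrt (2 / 3)) s, dist p (φ i)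
    ≤ D / 2 → ∃ j : Fin N, dist (x i) (x j) ≤ D ∧ φ j = p)) :=
  fun hCensus hdev hGap => by
    obtain ⟨D₀, hD⟩ := hdev
    exact ⟨D₀, fun N x i D hD₀ hGood hFF => hD N x i D hD₀ hGood hFF
      (fun j hj => zchart_of_deep16 hGap hCensus N x i D hGood hFF j hj)
      (fun j j' T T' e e' hj hj' hne hb hc hc' => transfers_of_deep16 hGap lens_five_points
        N x i D hGood j j' T T' e e' hj hj' hne hb hc hc')⟩

/-- **`stub_combinatorialLayering` (window `16 * D`) from the census in deep form** `(S3δ-deep)`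
(window `2 * D'`, used at `D' := 8 D`) and `(H_develop)` at window `16 * D`. [folklore] -/
theorem stub_combinatorialLayering_of_deepParts16 :
    (∀ (N : ℕ) (x : Fin N → EuclideanSpace ℝ (Fin 3)) (i : Fin N) (D : ℝ), (∀ j : Fin N, dist (x
    i) (x j) ≤ 2 * D → ((∀ j' : Fin N, dist (x j) (x j') ≤ 11 / 10 → ∀ k : Fin N, k ≠ j' → (55 :
    ℝ) / 57 ≤ dist (x j') (x k)) ∧ (Finset.univ.filter fun j' : Fin N => j' ≠ j ∧ dist (x j) (x
    j') ≤ 1).card = 12 ∧ (Finset.univ.filter fun j' : Fin N => j' ≠ j ∧ dist (x j) (x j') ≤ 11 /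
    10).card ≤ 12)) → ∀ j : Fin N, dist (x i) (x j) + 10 ≤ 2 * D → ∃ e : Fin 12 → Fin N,
    Function.Injective e ∧ (∀ a : Fin 12, e a ≠ j ∧ dist (x j) (x (e a)) ≤ 1) ∧ ((∀ a b : Fin
    12, a ≠ b → (dist (x (e a)) (x (e b)) ≤ 1 ↔ Literature.Geometry.DiscreteGeometry.fccAdj a
    b)) ∨ (∀ a b : Fin 12, a ≠ b → (dist (x (e a)) (x (e b)) ≤ 1 ↔
    Literature.Geometry.DiscreteGeometry.hcpAdj a b)) ∨ (∀ a b : Fin 12, a ≠ b → (dist (x (e a))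
    (x (e b)) ≤ 1 ↔
    Summit.AtomisticToContinuum.Crystallization.Theorems.SquareWellLayerCakeGapTwelveToBarlow.bppAdj
    a b = true)))) → (∃ D₀ : ℝ, ∀ (N : ℕ) (x : Fin N → EuclideanSpace ℝ (Fin 3)) (i : Fin N) (D
    : ℝ), D₀ ≤ D → (∀ j : Fin N, dist (x i) (x j) ≤ 16 * D → ((∀ j' : Fin N, dist (x j) (x j') ≤
    11 / 10 → ∀ k : Fin N, k ≠ j' → (55 : ℝ) / 57 ≤ dist (x j') (x k)) ∧ (Finset.univ.filter fun
    j' : Fin N => j' ≠ j ∧ dist (x j) (x j') ≤ 1).card = 12 ∧ (Finset.univ.filter fun j' : Fin N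
    => j' ≠ j ∧ dist (x j) (x j') ≤ 11 / 10).card ≤ 12)) → (∀ j k : Fin N, dist (x i) (x j) ≤ 16
    * D → ¬ (j ≠ k ∧ dist (x j) (x k) ≤ 1 ∧ (Finset.univ.filter fun l : Fin N => l ≠ j ∧ l ≠ k ∧
    dist (x j) (x l) ≤ 1 ∧ dist (x k) (x l) ≤ 1).card = 5)) → (∀ j : Fin N, dist (x i) (x j) +
    10 ≤ 16 * D → ∃ (T : Fin 12 → Fin 3 → ℤ) (e : Fin 12 → Fin N), ((((T = fun a : Fin 12 => 3 •
    Literature.Geometry.DiscreteGeometry.fccTab a) ∨ T =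
    Literature.Geometry.DiscreteGeometry.hcpTab) ∧ Function.Injective e ∧ (∀ a : Fin 12, e a ≠ j
    ∧ dist (x j) (x (e a)) ≤ 1) ∧ (∀ k : Fin N, k ≠ j → dist (x j) (x k) ≤ 1 → ∃ a : Fin 12, e a
    = k) ∧ (∀ a b : Fin 12, a ≠ b → (dist (x (e a)) (x (e b)) ≤ 1 ↔
    Literature.Geometry.DiscreteGeometry.sqNormInt (T a - T b) = 18))))) → (∀ (j j' : Fin N) (T
    T' : Fin 12 → Fin 3 → ℤ) (e e' : Fin 12 → Fin N), dist (x i) (x j) + 10 ≤ 16 * D → dist (x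
    i) (x j') + 10 ≤ 16 * D → j ≠ j' → dist (x j) (x j') ≤ 1 → ((((T = fun a : Fin 12 => 3 •
    Literature.Geometry.DiscreteGeometry.fccTab a) ∨ T =
    Literature.Geometry.DiscreteGeometry.hcpTab) ∧ Function.Injective e ∧ (∀ a : Fin 12, e a ≠ j
    ∧ dist (x j) (x (e a)) ≤ 1) ∧ (∀ k : Fin N, k ≠ j → dist (x j) (x k) ≤ 1 → ∃ a : Fin 12, e a
    = k) ∧ (∀ a b : Fin 12, a ≠ b → (dist (x (e a)) (x (e b)) ≤ 1 ↔
    Literature.Geometry.DiscreteGeometry.sqNormInt (T a - T b) = 18)))) → ((((T' = fun a : Fin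
    12 => 3 • Literature.Geometry.DiscreteGeometry.fccTab a) ∨ T' =
    Literature.Geometry.DiscreteGeometry.hcpTab) ∧ Function.Injective e' ∧ (∀ a : Fin 12, e' a ≠
    j' ∧ dist (x j') (x (e' a)) ≤ 1) ∧ (∀ k : Fin N, k ≠ j' → dist (x j') (x k) ≤ 1 → ∃ a : Fin
    12, e' a = k) ∧ (∀ a b : Fin 12, a ≠ b → (dist (x (e' a)) (x (e' b)) ≤ 1 ↔
    Literature.Geometry.DiscreteGeometry.sqNormInt (T' a - T' b) = 18)))) → ∀ a a' b b' : Fin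
    12, e a = e' b → e a' = e' b' → Literature.Geometry.DiscreteGeometry.sqNormInt (T a - T a')
    = Literature.Geometry.DiscreteGeometry.sqNormInt (T' b - T' b')) → ∃ s : ℤ → ℤ, IsHaggSeq s
    ∧ ∃ φ : Fin N → EuclideanSpace ℝ (Fin 3), (∀ j : Fin N, dist (x i) (x j) ≤ D → φ j ∈
    barlowStacking 1 (Real.sqrt (2 / 3)) s) ∧ (∀ j j' : Fin N, dist (x i) (x j) ≤ D → dist (x i)
    (x j') ≤ D → j ≠ j' → φ j ≠ φ j') ∧ (∀ j j' : Fin N, dist (x i) (x j) ≤ D → dist (x i) (x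
    j') ≤ D → j ≠ j' → (dist (x j) (x j') ≤ 1 ↔ dist (φ j) (φ j') = 1)) ∧ (∀ p ∈ barlowStacking
    1 (Real.sqrt (2 / 3)) s, dist p (φ i) ≤ D / 2 → ∃ j : Fin N, dist (x i) (x j) ≤ D ∧ φ j =
    p)) → ((∀ (N : ℕ) (x : Fin N → EuclideanSpace ℝ (Fin 3)) (i j : Fin N), (∀ l : Fin N, dist
    (x i) (x l) ≤ 4 → ((∀ j' : Fin N, dist (x l) (x j') ≤ 11 / 10 → ∀ k : Fin N, k ≠ j' → (55 :
    ℝ) / 57 ≤ dist (x j') (x k)) ∧ (Finset.univ.filter fun j' : Fin N => j' ≠ l ∧ dist (x l) (x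
    j') ≤ 1).card = 12 ∧ (Finset.univ.filter fun j' : Fin N => j' ≠ l ∧ dist (x l) (x j') ≤ 11 /
    10).card ≤ 12)) → 1 < dist (x i) (x j) → (131 : ℝ) / 100 ≤ dist (x i) (x j)) → ∃ D₀ : ℝ, ∀
    (N : ℕ) (x : Fin N → EuclideanSpace ℝ (Fin 3)) (i : Fin N) (D : ℝ), D₀ ≤ D → (∀ j : Fin N,
    dist (x i) (x j) ≤ 16 * D → ((∀ j' : Fin N, dist (x j) (x j') ≤ 11 / 10 → ∀ k : Fin N, k ≠
    j' → (55 : ℝ) / 57 ≤ dist (x j') (x k)) ∧ (Finset.univ.filter fun j' : Fin N => j' ≠ j ∧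
    dist (x j) (x j') ≤ 1).card = 12 ∧ (Finset.univ.filter fun j' : Fin N => j' ≠ j ∧ dist (x j)
    (x j') ≤ 11 / 10).card ≤ 12)) → (∀ j k : Fin N, dist (x i) (x j) ≤ 16 * D → ¬ (j ≠ k ∧ dist
    (x j) (x k) ≤ 1 ∧ (Finset.univ.filter fun l : Fin N => l ≠ j ∧ l ≠ k ∧ dist (x j) (x l) ≤ 1
    ∧ dist (x k) (x l) ≤ 1).card = 5)) → ∃ s : ℤ → ℤ, IsHaggSeq s ∧ ∃ φ : Fin N → EuclideanSpace
    ℝ (Fin 3), (∀ j : Fin N, dist (x i) (x j) ≤ D → φ j ∈ barlowStacking 1 (Real.sqrt (2 / 3))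
    s) ∧ (∀ j j' : Fin N, dist (x i) (x j) ≤ D → dist (x i) (x j') ≤ D → j ≠ j' → φ j ≠ φ j') ∧
    (∀ j j' : Fin N, dist (x i) (x j) ≤ D → dist (x i) (x j') ≤ D → j ≠ j' → (dist (x j) (x j')
    ≤ 1 ↔ dist (φ j) (φ j') = 1)) ∧ (∀ p ∈ barlowStacking 1 (Real.sqrt (2 / 3)) s, dist p (φ i)
    ≤ D / 2 → ∃ j : Fin N, dist (x i) (x j) ≤ D ∧ φ j = p)) :=
  fun hCensusD hdev hGap => by
    obtain ⟨D₀, hD⟩ := hdev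
    exact ⟨D₀, fun N x i D hD₀ hGood hFF => hD N x i D hD₀ hGood hFF
      (fun j hj => zchart_of_deepCensus hCensusD N x i (8 * D) (fun j hj => hGood j (by linarith))
        (fun j k hj => hFF j k (by linarith)) j (by linarith))
      (fun j j' T T' e e' hj hj' hne hb hc hc' => transfers_of_deep16 hGap lens_five_points
        N x i D hGood j j' T T' e e' hj hj' hne hb hc hc')⟩

end Summit.AtomisticToContinuum.Crystallization.Theorems.SquareWellLayerCakeGapTwelveToBarlow
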